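import Summits.BirchSwinnertonDyer.BirchSwinnertonDyer.Theorems.PrintCf2SplitBadEisensteinTwoOddSocketObstruction
import Literature.NumberTheory.EllipticCurves.BSDShaProofs
import HarnessLib

/-!
# Crux `PrintCf2.SplitBadTwoRankOneOfFacts` (item 20368), line `eisenstein_two_bdp_line` (skeleton v7 40d712da) — the PARITY OBSTRUCTION AT `2`,
# BSD-FREE: on a Heegner datum of a curve with `4 ∣ N`, «integral ♭-BDP frame + ♭-IMC equality + Liu–Zhang–Zhang» force the net `2`-adic
# correction `τ` of ANY (∅,0) control formula at `T = 0` to be ODD — by Cassels–Tate alone (no `BSD₂`, no Milne, no `K`-side identity)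

Cell `bsd-print-cf2`, seat `bsd-line-cf2-p1-w2` g4 (prover, width seat on crux stmt-BirchSwinnertonDyer-20368; lead `bsd-line-cf2-p1` g6).
`--supports stmt-BirchSwinnertonDyer-20368` (helper). Theses-free; THEOREMS ONLY (0 definitions, 0 named facts, 0 `sorry`); CONDITIONAL on
`hL : LiuZhangZhang2018.thm151_thm153_modularCurve_heegnerVector_additive` and on the Cassels–Tate pairing over the Heegner field
(`hCT : WeierstrassCurve.exists_casselsTate_pairing (K := K)`, Cassels 1962 / Tate 1963, statement-only named fact of the tree). BSD is proved
for no curve by any of this; nothing registered is negated unconditionally; no summit statement is proved by this seat.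

WHAT THIS IS. The cell's two kernel readings of the control stub at `2` disagree: -w2 g3's `PrintCf2SplitBadEisensteinTwoOddSocketObstruction`
refutes the odd-`p` socket (`τ = 0`) GIVEN the `K`-side `2`-part of BSD (or `BSD₂(W) ∧ BSD₂(W^{d_K}) ∧` Milne), and the lead g6's
`…ControlAtTwoOfAtoms` (announced 10:05Z) derives `τ = 0` from four finiteness atoms + Poitou–Tate, concluding that «granted `BSD₂`, exactly
one typed `2`-power constant is off by one». THIS FILE removes `BSD₂` from that sentence. The core `charExponent_eq_of_flatIMCEq_two` (frame +
♭-IMC equality + LZZ ⟹ `n = 1 + 2·ord₂ log_ω P − 2·ord₂ c`) makes the control exponent `n` ODD; any control formula of the atoms' shape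
`n = ord₂ #Ш(E_K)[2^∞] + 2·(ord₂ log_ω P − ord₂ [E(K):ℤP]) + ord₂ ∏_w c_w(E_K) + τ` has `n ≡ τ (mod 2)`, because `#Ш(E_K)` is a SQUARE
(Cassels–Tate; `Ш(E_K)` finite by Kolyvagin) and `∏_w c_w(E_K) = (∏_ℓ c_ℓ(W))²` over a Heegner field (tree theorem
`X11b.tamagawaProduct_baseChange_eq_sq_of_heegner`). Hence:
* `correction_odd_of_core` (arithmetic): `n = s + 2(ℓ − i) + t + τ`, `n = 1 + 2ℓ − 2v`, `s`, `t` even ⟹ `τ` odd;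
* **`correction_odd_of_flatIMCEq_two_of_casselsTate`**: on the line's datum, frame + ♭-IMC eq + `HasCharValuationAt n` with `n` of the atoms'
  shape (correction `τ`) ⟹ `Odd τ` — so `τ = 0` (bsd-schneider's socket, the lead's four-atom machine) AND every even `τ` are excluded, while
  the registered `stub_control_two` (`τ = 1`) is the smallest admissible value;
* **`not_additiveControlOnTreeAt_two_of_flatIMCEq_of_casselsTate`**: -w2 g3's obstruction with its `K`-side hypothesis `hkSide` REPLACED by
  `hCT` — `¬ SchneiderFree.AdditiveControlOnTreeAt 2 κ 𝔭′ γ (embAt 𝔭′) P`, BSD-free;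
* `…_of_print`: the same with non-torsion / rank one / `Ш` finite supplied by «PRINTS(2)» (`ToricPublishedInputs`: Gross–Zagier, Kolyvagin,
  modularity) from `r_an(W) = 1` and `L(W^{(d_K)}, 1) ≠ 0`.
READING for the lead: the clash between {frame predicate `R1.IsBDPLFunctionInt 2`, LZZ as typed, ♭-IMC equality as equality of ideals} and
{the four atoms + PT} is a PARITY clash at `T = 0`, independent of `BSD₂`: if the atoms hold on `49a1^{(d)}/K″`, then NO frame `Q` in
Castella's normalisation satisfies the ♭-IMC equality at `𝔭′` (stubs 1+2+3 jointly false there); if stubs 1+2+3 hold, an atom fails and the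
true correction is odd (`+1` registered). `BSD₂` decides nothing here; the numerics that decide are the atoms' (base Selmer count at `2`).

References: [JetchevSkinnerWan2017] Thm. 3.3.1, Prop. 3.2.1 (shape); [Castella2018] Thm. 2.3; [LiuZhangZhang2018] Thm 1.5.1/1.5.3;
[Cassels1962] / [SilvermanAEC2009] Thm. X.4.14 (square order of finite `Ш`); [GrossZagier1986] V.(2.2).
-/

set_option autoImplicit false

-- D-0017 layout: summit = sub-problem, so `Summit.BirchSwinnertonDyer.BirchSwinnertonDyer.…` is the mandated namespace of Theorems files.
set_option linter.dupNamespace false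

noncomputable section

open scoped Classical MatrixGroups ModularForm Topology NumberField

namespace Summit.BirchSwinnertonDyer.BirchSwinnertonDyer.Theorems.PrintCf2.EisensteinTwo

open Filter CongruenceSubgroup WeierstrassCurve NumberField IsDedekindDomain Field PowerSeries
  Literature.NumberTheory.EllipticCurves Literature.NumberTheory.EllipticCurves.ModularForms
  Literature.NumberTheory.EllipticCurves.LiuZhangZhang2018 Literature.NumberTheory.EllipticCurves.Rank1Residual
  Literature.NumberTheory.EllipticCurves.Rank1Residual.Typed Literature.NumberTheory.EllipticCurves.KrizLi2019
  Literature.NumberTheory.GaloisRepresentations Literature.NumberTheory.GaloisCohomology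
  Summit.BirchSwinnertonDyer.Rank1Residual Summit.BirchSwinnertonDyer.Rank1Residual.X11b
  Summit.BirchSwinnertonDyer.Rank1Residual.X11b.AcSelmer Summit.BirchSwinnertonDyer.Rank1Residual.X11b.CongruenceLimit
  Summit.BirchSwinnertonDyer.Rank1Residual.X11b.Halves Summit.BirchSwinnertonDyer.Rank1Residual.X2
  Summit.BirchSwinnertonDyer.Rank1Residual.Additive
  Summit.BirchSwinnertonDyer.BirchSwinnertonDyer.Theses.UniversalToricDescent
  Summit.BirchSwinnertonDyer.BirchSwinnertonDyer.Theorems.UniversalToricDescentWaldspurgerFlat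

/-! ## §1 Arithmetic: the parity of the correction -/

/-- **The correction of a control formula is ODD under the core (arithmetic).** Write a (∅,0) control exponent at `T = 0` as
`n = s + 2·(ℓ − i) + t + τ` (`s = ord₂ #Ш(E_K)[2^∞]`, `ℓ = ord₂ log_ω P`, `i = ord₂ [E(K):ℤP]`, `t = ord₂ ∏_w c_w(E_K)`, `τ` the net correction).
If the analytic core gives `n = 1 + 2ℓ − 2v` (`v = ord₂ c`) and `s`, `t` are EVEN, then `τ` is ODD. [cite: JetchevSkinnerWan2017, Thm. 3.3.1 (arXiv:1512.06894 p. 11) (shape)] -/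
theorem correction_odd_of_core {n s ℓ i t τ v : ℤ} (hctl : n = s + 2 * (ℓ - i) + t + τ)
    (hcore : n = 1 + 2 * ℓ - 2 * v) (hs : Even s) (ht : Even t) : Odd τ := by
  obtain ⟨s', hs'⟩ := hs
  obtain ⟨t', ht'⟩ := ht
  refine ⟨i - v - s' - t', ?_⟩
  linarith

/-- **Corollary (arithmetic): an EVEN correction is impossible under the core** — in particular the odd-`p` socket's `τ = 0`.
[cite: JetchevSkinnerWan2017, Thm. 3.3.1 (arXiv:1512.06894 p. 11) (shape)] -/
theorem not_even_correction_of_core {n s ℓ i t τ v : ℤ} (hctl : n = s + 2 * (ℓ - i) + t + τ)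
    (hcore : n = 1 + 2 * ℓ - 2 * v) (hs : Even s) (ht : Even t) : ¬ Even τ :=
  fun hτ ↦ (Int.not_even_iff_odd.mpr (correction_odd_of_core hctl hcore hs ht)) hτ

/-! ## §2 The two even inputs over a Heegner field: `#Ш(E_K)` (Cassels–Tate) and `∏_w c_w(E_K)` (a square) -/

section Inputs

variable (W : WeierstrassCurve ℚ) [W.IsElliptic] (K : Type) [Field K] [NumberField K]

/-- **`ord₂ #Ш(E_K)[2^∞]` is EVEN** once `Ш(E_K)` is finite, granting the Cassels–Tate pairing over `K`: `#Ш(E_K)` is a perfect square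
(`WeierstrassCurve.isSquare_shaOrder_of_casselsTate`) and the `2`-primary component carries the full `2`-adic valuation. Stated for every prime `p`.
[cite: SilvermanAEC2009, Thm. X.4.14 (square order of finite Ш)] -/
theorem even_padicValNat_card_primaryComponent_sha_of_casselsTate (p : ℕ) [Fact p.Prime]
    (hCT : WeierstrassCurve.exists_casselsTate_pairing (K := K)) (hfin : (W.baseChange K).ShaFinite) :
    Even (padicValNat p (Nat.card (AddCommGroup.primaryComponent (W.baseChange K).sha p))) := by
  haveI : Finite (W.baseChange K).sha := hfin
  rw [Literature.NumberTheory.EllipticCurves.padicValNat_card_addPrimaryComponent p]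
  obtain ⟨m, hm⟩ := WeierstrassCurve.isSquare_shaOrder_of_casselsTate hCT (W.baseChange K) hfin
  have hpos : 0 < (W.baseChange K).shaOrder := (W.baseChange K).shaOrder_pos hfin
  have hm0 : m ≠ 0 := by
    rintro rfl
    rw [mul_zero] at hm
    exact hpos.ne' hm
  change Even (padicValNat p (W.baseChange K).shaOrder)
  rw [hm, padicValNat.mul hm0 hm0]
  exact ⟨_, rfl⟩

/-- **`ord_p ∏_w c_w(E_K)` (split product = full product) is EVEN over a Heegner field**, every prime `p`: `∏_w c_w(E_K) = (∏_ℓ c_ℓ(W))²`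
(`X11b.tamagawaProduct_baseChange_eq_sq_of_heegner`). [cite: JetchevSkinnerWan2017, §7.3.1 (eq:tamK)] -/
theorem even_padicValNat_tamagawaProductSplit_of_heegner (p : ℕ) [Fact p.Prime] (hK : IsImaginaryQuadratic K)
    {N : ℕ} (hN : W.conductorNorm ℤ = N) (hHN : SatisfiesHeegnerHypothesis N K) :
    Even (padicValNat p (X11b.tamagawaProductSplit W K)) := by
  rw [X11b.padicValNat_tamagawaProductSplit_eq_of_heegner_prime W K p hN hHN,
    X11b.padicValNat_tamagawaProduct_baseChange_of_heegner_prime W K p hK hN hHN]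
  exact even_two_mul _

end Inputs

/-! ## §3 The parity obstruction on the line's datum (BSD-free) -/

/-- **PARITY OBSTRUCTION AT `2` (BSD-free).** Data: `W/ℚ` globally minimal, `4 ∣ N_W`; `K` imaginary quadratic with the Heegner hypothesis for
`N_W`; the Heegner datum `(Dt, H, ι_K, P)`, `P` non-torsion, `rank E(K) = 1`, `Ш(E_K)` finite; `(κ, γ)` anticyclotomic at `2`; degree-one primes
`𝔭`, `𝔭′` above `2`; `ι′` inducing `𝔭`; an integral ♭-BDP frame `(Ω_K, Ω_p, Q)` of `Dt.f` at `𝔭`; the ♭-IMC EQUALITY at `𝔭′` against `Q`;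
a control exponent `n` (`XAc.HasCharValuationAt … 𝔭′ … n`) of the ATOMS' SHAPE with net correction `τ`:
`n = ord₂ #Ш(E_K)[2^∞] + 2·(ord₂ log_ω P − ord₂ [E(K):ℤP]) + ord₂ ∏_{w split} c_w(E_K) + τ`. CONCLUSION, granting Liu–Zhang–Zhang (`hL`) and the
Cassels–Tate pairing over `K` (`hCT`): `τ` is ODD. No `BSD₂`, no Milne, no `K`-side identity. Proof: core `n = 1 + 2·ord₂ log_ω P − 2·ord₂ c`
(`charExponent_eq_of_flatIMCEq_two`), §2, §1. [cite: JetchevSkinnerWan2017, Thm. 3.3.1 (arXiv:1512.06894 p. 11) (shape)]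
[cite: LiuZhangZhang2018, Thm 1.5.1 and Thm 1.5.3] [cite: SilvermanAEC2009, Thm. X.4.14] -/
theorem correction_odd_of_flatIMCEq_two_of_casselsTate
    (hL : thm151_thm153_modularCurve_heegnerVector_additive)
    (W : WeierstrassCurve ℚ) [W.IsElliptic] [W.IsGloballyMinimal]
    (K : Type) [Field K] [NumberField K] (hCT : WeierstrassCurve.exists_casselsTate_pairing (K := K))
    (κ : ZpExtension K 2) (γ : absoluteGaloisGroup K) [Fact (κ.IsTopGenerator γ)] {N : ℕ} [NeZero N]
    (Dt : ModularParametrizationData W N) (H : HeegnerDatum N (NumberField.discr K))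
    (ιK : K →+* ℂ) (P : (W.baseChange K).toAffine.Point)
    (hN : W.conductorNorm ℤ = N) (h4N : 2 ^ 2 ∣ N) (hK : IsImaginaryQuadratic K)
    (hHN : SatisfiesHeegnerHypothesis N K) (hκ : κ.IsAnticyclotomic)
    (hP : WeierstrassCurve.Affine.Point.map ιK.toRatAlgHom P = heegnerPointComplex Dt H)
    (hPinf : ¬ IsOfFinAddOrder P) (hrk : (W.baseChange K).mordellWeilRank = 1) (hfinK : (W.baseChange K).ShaFinite)
    (𝔭 : HeightOneSpectrum (𝓞 K)) (h𝔭 : ((2 : ℕ) : 𝓞 K) ∈ 𝔭.asIdeal) (he : 𝔭.asIdeal.ramificationIdx (𝓞 ℚ) = 1)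
    (hf : 𝔭.asIdeal.inertiaDeg (𝓞 ℚ) = 1)
    (𝔭' : HeightOneSpectrum (𝓞 K)) (h𝔭' : ((2 : ℕ) : 𝓞 K) ∈ 𝔭'.asIdeal) (he' : 𝔭'.asIdeal.ramificationIdx (𝓞 ℚ) = 1)
    (hf' : 𝔭'.asIdeal.inertiaDeg (𝓞 ℚ) = 1)
    (ι' : PadicAlgCl 2 ≃+* ℂ) (hind : SchneiderFree.BranchInducesPrime 2 ι' 𝔭)
    {ΩK' : ℂ} {Ωp' : ℂ_[2]} {Q : PowerSeries (PadicComplexInt 2)} (hΩK' : ΩK' ≠ 0) (hΩp' : Ωp' ≠ 0)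
    (hQ : R1.IsBDPLFunctionInt 2 ι' 𝔭 κ γ Dt.f ΩK' Ωp' Q)
    (hEq : (XAc.charIdeal (W.baseChange K) 2 κ 𝔭' ∅ γ).map (PowerSeries.map (R1.toCpInt 2)) = Ideal.span {Q})
    {n : ℕ} (hn : XAc.HasCharValuationAt (W.baseChange K) 2 κ 𝔭' ∅ γ n) {τ : ℤ}
    (hctl : (n : ℤ) = (padicValNat 2 (Nat.card (AddCommGroup.primaryComponent (W.baseChange K).sha 2)) : ℤ) +
      2 * (X11b.padicLogOrd W 2 (embAt K 2 𝔭' h𝔭' he' hf') P - (padicValNat 2 (AddSubgroup.zmultiples P).index : ℤ)) +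
      padicValNat 2 (X11b.tamagawaProductSplit W K) + τ) :
    Odd τ := by
  have h2N : (2 : ℕ) ∣ N := dvd_trans (dvd_pow_self 2 two_ne_zero) h4N
  -- `d_K ≡ 1 (mod 8)`, so `d_K < −4`
  have hd8 : NumberField.discr K % 8 = 1 := Literature.SatisfiesHeegnerHypothesis.discr_emod_eight hK.1 hHN h2N
  have hdneg : NumberField.discr K < 0 := IsImaginaryQuadratic.discr_neg hK
  have hd4 : NumberField.discr K < -4 := by omega
  -- the analytic core: `n = 1 + 2·ord₂ log_ω P − 2·ord₂ c`
  have hcore := charExponent_eq_of_flatIMCEq_two hL W K κ γ Dt H ιK P hN h4N hK hd4 hHN hκ hP hPinf hrk 𝔭 h𝔭 he hf 𝔭' h𝔭' he'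
    hf' ι' hind hΩK' hΩp' hQ hn hEq
  -- the two even inputs
  have hs := even_padicValNat_card_primaryComponent_sha_of_casselsTate W K 2 hCT hfinK
  have ht := even_padicValNat_tamagawaProductSplit_of_heegner W K 2 hK hN hHN
  obtain ⟨s', hs'⟩ := hs
  obtain ⟨t', ht'⟩ := ht
  refine correction_odd_of_core (s := (padicValNat 2 (Nat.card (AddCommGroup.primaryComponent (W.baseChange K).sha 2)) : ℤ))
    (t := (padicValNat 2 (X11b.tamagawaProductSplit W K) : ℤ)) hctl hcore ⟨s', by exact_mod_cast hs'⟩ ⟨t', by exact_mod_cast ht'⟩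

/-- **The odd-`p` control socket is OBSTRUCTED at `2`, BSD-free** (-w2 g3's `not_additiveControlOnTreeAt_two_of_flatIMCEq_of_kSide` with the
`K`-side identity `hkSide` REPLACED by the Cassels–Tate pairing `hCT`): on the datum above, frame + ♭-IMC equality + LZZ + Cassels–Tate ⟹
`¬ SchneiderFree.AdditiveControlOnTreeAt 2 κ 𝔭′ γ (embAt 𝔭′) P` (the socket is the case `τ = 0`, which is even).
[cite: JetchevSkinnerWan2017, Thm. 3.3.1 (arXiv:1512.06894 p. 11) (shape)] [cite: LiuZhangZhang2018, Thm 1.5.1 and Thm 1.5.3]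
[cite: SilvermanAEC2009, Thm. X.4.14] -/
theorem not_additiveControlOnTreeAt_two_of_flatIMCEq_of_casselsTate
    (hL : thm151_thm153_modularCurve_heegnerVector_additive)
    (W : WeierstrassCurve ℚ) [W.IsElliptic] [W.IsGloballyMinimal]
    (K : Type) [Field K] [NumberField K] (hCT : WeierstrassCurve.exists_casselsTate_pairing (K := K))
    (κ : ZpExtension K 2) (γ : absoluteGaloisGroup K) [Fact (κ.IsTopGenerator γ)] {N : ℕ} [NeZero N]
    (Dt : ModularParametrizationData W N) (H : HeegnerDatum N (NumberField.discr K))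
    (ιK : K →+* ℂ) (P : (W.baseChange K).toAffine.Point)
    (hN : W.conductorNorm ℤ = N) (h4N : 2 ^ 2 ∣ N) (hK : IsImaginaryQuadratic K)
    (hHN : SatisfiesHeegnerHypothesis N K) (hκ : κ.IsAnticyclotomic)
    (hP : WeierstrassCurve.Affine.Point.map ιK.toRatAlgHom P = heegnerPointComplex Dt H)
    (hPinf : ¬ IsOfFinAddOrder P) (hrk : (W.baseChange K).mordellWeilRank = 1) (hfinK : (W.baseChange K).ShaFinite)
    (𝔭 : HeightOneSpectrum (𝓞 K)) (h𝔭 : ((2 : ℕ) : 𝓞 K) ∈ 𝔭.asIdeal) (he : 𝔭.asIdeal.ramificationIdx (𝓞 ℚ) = 1)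
    (hf : 𝔭.asIdeal.inertiaDeg (𝓞 ℚ) = 1)
    (𝔭' : HeightOneSpectrum (𝓞 K)) (h𝔭' : ((2 : ℕ) : 𝓞 K) ∈ 𝔭'.asIdeal) (he' : 𝔭'.asIdeal.ramificationIdx (𝓞 ℚ) = 1)
    (hf' : 𝔭'.asIdeal.inertiaDeg (𝓞 ℚ) = 1)
    (ι' : PadicAlgCl 2 ≃+* ℂ) (hind : SchneiderFree.BranchInducesPrime 2 ι' 𝔭)
    {ΩK' : ℂ} {Ωp' : ℂ_[2]} {Q : PowerSeries (PadicComplexInt 2)} (hΩK' : ΩK' ≠ 0) (hΩp' : Ωp' ≠ 0)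
    (hQ : R1.IsBDPLFunctionInt 2 ι' 𝔭 κ γ Dt.f ΩK' Ωp' Q)
    (hEq : (XAc.charIdeal (W.baseChange K) 2 κ 𝔭' ∅ γ).map (PowerSeries.map (R1.toCpInt 2)) = Ideal.span {Q}) :
    ¬ SchneiderFree.AdditiveControlOnTreeAt 2 κ 𝔭' γ (embAt K 2 𝔭' h𝔭' he' hf') P := by
  rintro ⟨n, hn, hnf⟩
  have hctl : (n : ℤ) = (padicValNat 2 (Nat.card (AddCommGroup.primaryComponent (W.baseChange K).sha 2)) : ℤ) +
      2 * (X11b.padicLogOrd W 2 (embAt K 2 𝔭' h𝔭' he' hf') P - (padicValNat 2 (AddSubgroup.zmultiples P).index : ℤ)) +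
      padicValNat 2 (X11b.tamagawaProductSplit W K) + 0 := by rw [add_zero]; exact hnf
  have hodd := correction_odd_of_flatIMCEq_two_of_casselsTate hL W K hCT κ γ Dt H ιK P hN h4N hK hHN hκ hP hPinf hrk hfinK 𝔭 h𝔭 he hf
    𝔭' h𝔭' he' hf' ι' hind hΩK' hΩp' hQ hEq hn hctl
  exact (Int.not_even_iff_odd.mpr hodd) ⟨0, rfl⟩

/-- **Same obstruction with the rank-one inputs supplied by «PRINTS(2)»** (`ToricPublishedInputs`: Gross–Zagier, Kolyvagin, modularity): for
`W` of analytic rank one and a Heegner field `K` with `L(W^{(d_K)}, 1) ≠ 0`, the Heegner point is non-torsion, `rank E(K) = 1` and `Ш(E_K)` is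
finite; then frame + ♭-IMC equality + LZZ + Cassels–Tate ⟹ `¬ SchneiderFree.AdditiveControlOnTreeAt 2 κ 𝔭′ γ (embAt 𝔭′) P`. Compared with
-w2 g3's `not_additiveControlOnTreeAt_two_of_flatIMCEq_of_bsdp`: the hypotheses `BSDp W 2`, `BSDp Wd 2`, Milne are GONE; `hCT` is new.
[cite: GrossZagier1986, V.(2.2)] [cite: SilvermanAEC2009, Thm. X.4.14] [cite: LiuZhangZhang2018, Thm 1.5.1 and Thm 1.5.3] -/
theorem not_additiveControlOnTreeAt_two_of_flatIMCEq_of_casselsTate_of_print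
    (hL : thm151_thm153_modularCurve_heegnerVector_additive) (hF : ToricPublishedInputs)
    (W : WeierstrassCurve ℚ) [W.IsElliptic] [W.IsGloballyMinimal]
    (K : Type) [Field K] [NumberField K] (hCT : WeierstrassCurve.exists_casselsTate_pairing (K := K))
    (κ : ZpExtension K 2) (γ : absoluteGaloisGroup K) [Fact (κ.IsTopGenerator γ)] {N : ℕ} [NeZero N]
    (Dt : ModularParametrizationData W N) (H : HeegnerDatum N (NumberField.discr K))
    (ιK : K →+* ℂ) (P : (W.baseChange K).toAffine.Point)
    (hN : W.conductorNorm ℤ = N) (h4N : 2 ^ 2 ∣ N) (hK : IsImaginaryQuadratic K)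
    (hHN : SatisfiesHeegnerHypothesis N K) (hκ : κ.IsAnticyclotomic)
    (hP : WeierstrassCurve.Affine.Point.map ιK.toRatAlgHom P = heegnerPointComplex Dt H)
    (hr : W.analyticRank = 1) (hLt : (W.quadraticTwist (NumberField.discr K : ℚ)).entireLFunction 1 ≠ 0)
    (𝔭 : HeightOneSpectrum (𝓞 K)) (h𝔭 : ((2 : ℕ) : 𝓞 K) ∈ 𝔭.asIdeal) (he : 𝔭.asIdeal.ramificationIdx (𝓞 ℚ) = 1)
    (hf : 𝔭.asIdeal.inertiaDeg (𝓞 ℚ) = 1)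
    (𝔭' : HeightOneSpectrum (𝓞 K)) (h𝔭' : ((2 : ℕ) : 𝓞 K) ∈ 𝔭'.asIdeal) (he' : 𝔭'.asIdeal.ramificationIdx (𝓞 ℚ) = 1)
    (hf' : 𝔭'.asIdeal.inertiaDeg (𝓞 ℚ) = 1)
    (ι' : PadicAlgCl 2 ≃+* ℂ) (hind : SchneiderFree.BranchInducesPrime 2 ι' 𝔭)
    {ΩK' : ℂ} {Ωp' : ℂ_[2]} {Q : PowerSeries (PadicComplexInt 2)} (hΩK' : ΩK' ≠ 0) (hΩp' : Ωp' ≠ 0)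
    (hQ : R1.IsBDPLFunctionInt 2 ι' 𝔭 κ γ Dt.f ΩK' Ωp' Q)
    (hEq : (XAc.charIdeal (W.baseChange K) 2 κ 𝔭' ∅ γ).map (PowerSeries.map (R1.toCpInt 2)) = Ideal.span {Q}) :
    ¬ SchneiderFree.AdditiveControlOnTreeAt 2 κ 𝔭' γ (embAt K 2 𝔭' h𝔭' he' hf') P := by
  obtain ⟨hGZ, hKo, -, hmod, -, -, -, -, -, -⟩ := hF
  -- non-torsion and Kolyvagin
  have hL0 : W.entireLFunction 1 = 0 := entireLFunction_one_eq_zero_of_analyticRank_eq_one hr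
  obtain ⟨-, hderiv⟩ := leadingLCoeff_eq_deriv_of_analyticRank_eq_one hr
  have hLK : LDerivEK W K ≠ 0 := by
    rw [lDerivEK_eq_deriv_mul W K hmod hL0]; exact mul_ne_zero hderiv hLt
  have hPinf : ¬ IsOfFinAddOrder P :=
    (lDerivEK_ne_zero_iff_not_isOfFinAddOrder W N K (hGZ _ W K) hK hHN ⟨Dt, H, ιK, hP⟩).mp hLK
  obtain ⟨hrk, hfinK⟩ := (hKo N W K) hK hHN ⟨Dt, H, ιK, hP⟩ hPinf
  exact not_additiveControlOnTreeAt_two_of_flatIMCEq_of_casselsTate hL W K hCT κ γ Dt H ιK P hN h4N hK hHN hκ hP hPinf hrk hfinK 𝔭 h𝔭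
    he hf 𝔭' h𝔭' he' hf' ι' hind hΩK' hΩp' hQ hEq

end Summit.BirchSwinnertonDyer.BirchSwinnertonDyer.Theorems.PrintCf2.EisensteinTwo

end
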